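import Literature.MathematicalPhysics.QuantumFieldTheory.Balaban1983to89.B14FlowStepPerturbed
import Literature.MathematicalPhysics.QuantumFieldTheory.Balaban1983to89.B12Beta
import Literature.MathematicalPhysics.QuantumFieldTheory.Balaban1983to89.FlowStep

/-!
# `Balaban1983to89.B14DeltaBeta` — C14, the (Δβ) display: what `δβ_{k+1}` IS, the two grades of its reconstructed
bound, and the bootstrap from CONDITIONAL smallness
(cell `pub-balaban`, unit `b2b-balaban-pv02` gen 5 = the B14 §3 lineage; node C14 of MISSING-B14.md v6 §8 = GAPS
G-sb14-4 (ASK of the strategist lineage `b2b-balaban-strat-b14`), a refinement of GAPS G-B14s-18 and a correction of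
G-B14s-22 §3(b); companion markdown `HOME/b2b-balaban-pv02/g5/C14-DeltaBeta.md`; sibling of `B14FlowStepPerturbed`)

HONEST FRAMING (cell rule, page 1 of everything): discharging the β sub-cell's wall makes Bałaban's UV stability
UNCONDITIONAL in the interval-hypothesis sense of [Balaban1989LargeFieldII] p. 355 — a real constructive-QFT result; it
is NOT the continuum limit and NOT the Clay problem.  THIS MODULE DISCHARGES NOTHING.  It (A) types WHAT the
perturbation `δβ_{k+1}` of reading (α) is — a difference of two instances of the PRINTED functional (I.1.20)–(I.1.22) —
as a structure of hypotheses, (B) records the two SHAPES which the B14 §3 lineage's reconstruction of the undisplayed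
estimate yields (NOT PRINTED, asserted by nobody; the companion markdown carries the per-term chain with every step
labelled printed / folklore / not printed), and (C) proves, over real sequences, that the strategist lineage's bootstrap
(`B14FlowStepPerturbed.absDelta_le_of_perturbedSplit`) closes from the WEAKER, conditional form of the bound which is
all the reconstruction honestly supports: "whenever the printed flow facts (2.6)–(2.9) and the layer-sum bound (2.46)
hold up to the horizon `k`, `|δ_k| ≤ b/2`".  VALUE = typed census item + kernel bookkeeping, NOT progress on any open
problem.  0 sorry.

ABSOLUTE RULE (cell rule, verbatim): "No internally-minted statement may enter as a cited fact. Every hypothesis is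
either kernel-proved in this package or a verbatim quotation of a PUBLISHED theorem with page reference. The
manuscript(s) under audit are NOT citable for their own disputed steps — they are the thing under adjudication;
programme-internal (2001/route/tribunal) claims are never citable."  Accordingly NOTHING below is a cited fact about
`δβ`: part (A) is a structure of HYPOTHESES whose fields quote the printed definitions they instantiate, part (B) are
`Prop`-valued SHAPES (definitions, asserting nothing), part (C) are implications over real sequences.

CITATION HEADER (lean-in-tree rule 2026-08-18).  Sources under audit: T. Bałaban, *Convergent renormalization expansions
for lattice gauge theories*, Commun. Math. Phys. **119**, 243–285 (1988) [Balaban1988Convergent] (cell paper B14 =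
[III]; journal page = PDF page + 242; renders `HOME/b2b-balaban-ref1/pages/1988-cmp119-convergent-renormalization/…
-p017,-p018,-p019,-p020,-p029,-p036,-p037,-p041-x2.png` READ by this unit for this module, 2026-08-18; (3.49) p. 280
as transcribed by this lineage in `HOME/b2b-balaban-pv02/B14-S3.md`, its algebra kernel-checked in `B14Sect3`); T. Bałaban, *Renormalization group approach to lattice gauge field theories. I*, Commun. Math. Phys.
**109**, 249–301 (1987) [Balaban1987RG1] (B12 = [I]; journal page = PDF page + 248; renders `…/1987-cmp109-rg-I-small-
field/…-p014,-p016-x2.png` READ).  What is reproduced: the sentences quoted verbatim in the next paragraph (LOCATED,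
not adjudicated); (2.6)–(2.9), (2.28), (2.46) enter through `B14` / `B14FlowStep`, (1.21)–(1.22) through `B12Beta`,
whose headers carry them verbatim.

WHAT PRINT SAYS (verbatim, renders as above).  [I] p. 262 [14]: *"A Gᶜ-valued gauge transformation u acts on pairs
(𝐔,𝐉) in the following way (𝐔,𝐉)ᵘ = (𝐔ᵘ, R(u)𝐉) = (u₋𝐔u₊⁻¹, R(u₋)𝐉), (1.10)"*; *"The space Uᶜ_j(X,α₀,α₁,γ₀) is a
union of orbits [(𝐔,𝐉)] determined by configurations 𝐔, 𝐉 satisfying the four conditions written below. (i) 𝐔 = U′U,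
U has values in the group G, |∂U − 1| < α₀ξ² on X, (1.11) … (ii) U′ = exp iξA′, A′ has values in the algebra 𝐠ᶜ,
|A′|, |∇ξ_U A′| < α₁ on X. (1.13)"*.  [I] p. 264 [16]: *"Let us denote 𝐄^{(j+1)}(g_j,B) = 𝐄^{(j+1)}(g_j,U_{j+1}(exp iB)). We define
Π^{ab}_{j+1,μν}(g_j,x,x′) = (δ²/(δB^a_μ(x)δB^b_ν(x′)) 𝐄^{(j+1)})(g_j,0). (1.20) This is the vacuum polarization tensor of
the theory defined by the j-th fluctuation field integral."*; *"The function 𝐄^{(j+1)} is gauge invariant, hence it is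
invariant with respect to global transformations V → R(v)V, v ∈ G, or B → R(v)B. The function (1.20) can be considered
as a function of μ, ν, x, x′, with values in the tensor product 𝐠⊗𝐠, and these values are invariant with respect to the
transformations R(v)⊗R(v), v ∈ G. This is possible only if they are proportional to the identity matrix, i.e. to
δ^{ab}."*; (1.21); *"Now we take a limit of these functions as T^{(j+1)} ↗ Z^d. This limit exists by the localized
representation (1.7)."*; (1.22) *"β_{j+1}(g_j) = … = Σ_x Π_{j+1,μν}(g_j,x)x_μx_ν for μ, ν arbitrary, μ ≠ ν"*; *"It is a
smooth function defined on the interval [0,γ], (or analytic), uniformly bounded on this interval together with all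
derivatives."*  [III] p. 259 [17], after (2.24): *"Here the coupling constants g_{j−1} are defined as
in (I.0.20)"*.  [III] p. 260 [18]: *"(2.31) |𝐑^{(j)}(X,(𝐔,𝐉))| ≤ g_j^{κ₀} exp(−κd_j(X)). Here κ₀ can be chosen
arbitrarily large, similarly as κ, if the other parameters are fixed properly, as in [I]."*; *"After the vacuum energy
renormalization we obtain a sum of marginal terms, i.e., terms with bounds O(1)(Lʲη)⁴g_j^{κ₀}exp(−κd_j(X)). The sum
over X is controlled by the exponential factor, and by the factor (Lʲη)⁴. The sum over j is controlled by g_j^{κ₀}."*;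
(2.33) *"𝐑^{(j)}(U_j) = Σ_X 𝐑^{(j)}(X,U_j)"*.  [III] p. 261 [19]: (2.34) *"|∂U−1|, |∂𝐔−1| < (1 − β(1 − 2^{−(j−n)}))
α_{0,n}ξ²(Lⁿξ)⁻²"*, (2.39) *"Lⁿξ|A′|, (Lⁿξ)²|∇ξ_U A′| < (1 − β(1−2^{−(j−n)}))α_{1,n} on X∩(Ω_n∖Ω_{n+1}) for n = 1,…,
j−1, or on X∩Ω_j for n = j."*; *"The spaces defined above are invariant with respect to G-valued gauge
transformations."*  [III] p. 271 [29]: *"the expression determined by the sum 𝐑′_k = Σ_{j=1}^{k₁} 𝐑^{(j)} is Euclidean covariant … It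
has the same covariance property as the expression determined by 𝐄_k, and we include it into 𝐄_k. The sum of the two
expressions, 𝐑′_k and 𝐄_k, is denoted also by 𝐄_k. The sum of the remaining terms 𝐑″_k = Σ_{j=k₁+1}^{k} 𝐑^{(j)} is
treated separately."*
[III] p. 278 [36]: *"The terms of the sum above satisfy the bounds (2.42), with the constant B₀ replaced by O(p₀³(g_k)).
Of course the integration with respect to t preserves the form of the representation, and the multiplication by g_k
yields small bounds."*; *"The important remark is that the terms 𝐄₀^{(k+1)}(Λ_{k+1},X,z) of this representation, for
X ⊂ Λ_{k+1}, do not depend on Λ_{k+1}, and coincide with the corresponding terms arising from the expressions defined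
on the whole lattice, i.e. in the framework of [I]."*  [III] p. 279 [37]: *"The coupling constant renormalization is
performed by subtracting β_{k+1}(g_k)A(φ_{k+1},U_{k+1}) from 𝐄^{(k+1)} − 𝐄^{(k+1)}(1), and by replacing the function
g_k^{−2}(·) in the action A(g_k^{−2}(·),U_{k+1}) by g_{k+1}^{−2}(·) defined by the equation (2.24) with j = k+1."*; *"The
basic expression to analyze, either in the proof of Theorem 2, or in the analysis of renormalization, is the difference
𝐄^{(j)}(Λ_j,U_k,z) − 𝐄^{(j)}(Λ_j,1,z). The field U_k may depend on the fluctuation field, as in the exponential in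
(3.15)."*  [III] p. 283 [41]: *"To get the expressions needed in the
fluctuation field integral, we differentiate these terms with respect to the parameter t_□ multiplying the fluctuation
field."*; *"The inequality (2.44) for the functions 𝐑^{(j)} can be proved in an almost identical way. We analyze these
functions as above, but we stop at the identity (3.49), where 𝐄^{(2)}(X,x,y,z) is replaced by 𝐑^{(2)}(X,x,y), and z is
an arbitrary point from X. Now all the terms on the right-hand side can be bounded by O(1)(LʲL⁻ⁿ)⁴g_j^{κ₀}exp(−κd_j(X)),
and this yields the inequality (2.44)."*
THE LOCATED POINT (objection-LOCATING, nothing adjudicated; GAPS G-sb14-4 / G-B14s-18 / G-B14s-22 §4).  Under READING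
(α) — B14's `β_{k+1}` in (2.24) IS (I.1.20)–(I.1.22) applied to B14's own whole-lattice family `𝐄^{(k+1)}` built from
the merged `𝐄_k ⊇ 𝐑′_k` (p. 271), which is what p. 259 *"defined as in (I.0.20)"* and p. 278 *"coincide with … the
framework of [I]"* say — the perturbation `δβ_{k+1} := β_{k+1} − βᴵ_{k+1}` (`βᴵ` = the same functional applied to the
𝐑′-free family, [I]'s) is, by the LINEARITY of (1.20) in `E^{(j+1)}` and of (1.22) in the kernel, the (1.22)-second-
moment of the polarization kernel of the DIFFERENCE `D^{(k+1)} := 𝐄^{(k+1)}[𝐄_k ∪ 𝐑′_k] − 𝐄^{(k+1)}[𝐄_k]` (part (A)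
below).  Print displays NO bound on it; p. 278 asserts bounds of the (2.42) shape *"with the constant B₀ replaced by
O(p₀³(g_k))"* for the terms, no more.  The B14 §3 lineage's RECONSTRUCTION (companion markdown §2; NOT PRINTED; order
of magnitude only) of the per-term chain — (2.31) sup bound; gauge invariance (iii) and the orbit structure (1.10)–
(1.13)/(2.34)–(2.39) of the analyticity domains; the vanishing of gauge-invariant first-order terms at the trivial
configuration for semisimple G (the rank-one case of the invariance argument print uses at p. 264 for (1.21), and the
reason (3.49) p. 280 starts at second order); print's second-order identity (3.49) / p. 283 applied to the
fluctuation-perturbed background;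
the counting behind *"(Lʲη)⁴"* (p. 260); Cauchy estimates — yields a FLAT layer sum (no factor `L^{−(k−j)}`, as
G-B14s-22 §3(d) already found) in two GRADES: (Δβ-a) [sup-norm/Cauchy grade, the background dependence extracted by a
Cauchy estimate at scale k+1]: `Σ_{j≤k} g_j^κ ≤ 1 ⟹ |δβ_{k+1}| ≤ D_a·Σ_{j≤k} g_j^κ` with `κ = κ₀ − 3` and `D_a` a
product of printed constants with NO factor `g_k²` (and no smallness of `D_a` is needed downstream: (2.46) at the
horizon bounds the layer sum itself by `g_k^{κ−6} ≤ γ^{κ−6}`, `flowControl_of_boundA_pow`); (Δβ-b) [[I] §5 grade, the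
background dependence extracted perturbatively at second order — the grade whose [I]-analogue is itself unprinted,
GAPS G-b12-2]: `|δβ_{k+1}| ≤ D_b·g_k²·Σ_{j≤k} g_j^κ`, the strategist lineage's binder.  CORRECTION of G-B14s-22 §3(b):
the weight `K_{j,k} = O((ε_k/α_{0,j})²)` there loses its `ε_k²` (the conversion factors `L^{∓4(k−j)}` of curvature
and count cancel exactly; what is left per layer is `α_{•,j}^{−2} ∝ g_j^{−2}`, whence `κ = κ₀ − 3` after absorbing the
logarithms into one power of `g_j`), and a plain Cauchy estimate in the fluctuation parameter gives only `L^{−2(k−j)}`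
per term (a DIVERGENT layer sum): the flat sum needs the second-order flux structure — exactly the kind of estimate
G-B14s-18 records as undisplayed.  The honest typed interface is therefore CONDITIONAL: the bound at scale `k` may use
the printed flow facts (2.6)–(2.9) and (2.46) up to the horizon `k` (which is what Bałaban's induction supplies and
what the bootstrap re-derives), and nothing finer than (Δβ-a) is claimed.
WHAT THIS MODULE PROVES.  (A) `AlphaBooking.split`: for a flow whose realised β-values ARE the (1.22)-second moments
of kernels `Π_full(j)`, with `Πᴵ(j)` the 𝐑′-free kernels and the two relevant lattice sums summable, `β_{j+1}(g_j) =
βᴵ_j + δ_j` with `δ_j :=` the second moment of `Π_full(j) − Πᴵ(j)` — the `hsplit` hypothesis of `B14FlowStepPerturbed`,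
DERIVED from the printed linearity (`secondMoment_add`).  (B) the shapes `CondSmall` (layer sum ≤ 1 ⟹ `|δ_k| ≤ θ`),
`CondSmallFC` (printed flow facts ∧ (2.46) up to the horizon ⟹ `|δ_k| ≤ θ`), `DeltaBoundA` (Δβ-a), `PerScaleRep` (the
per-layer form of the reconstruction) and the implications `PerScaleRep ⟹ DeltaBoundA ⟹ CondSmall ⟹ CondSmallFC`,
`flat (Δβ-b) ⟹ CondSmall` (`condSmall_of_flat`: the strategist's hypothesis is a special case); the absorption
arithmetic `g·(log g⁻²)^q ≤ (2q)^q` (`g_mul_logpow_le`, how the logarithms cost one power of `g_j`).  (C)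
`absDelta_le_of_condSmallFC`, `flowControl_of_condSmallFC`: the bootstrap in the scale from `CondSmallFC` — strong
induction on `k`: the induction hypothesis `|δ_j| ≤ b/2 (j < k)` gives (AvAF) with slope `b/2` and the upper bound
`β′ + b/2` up to the horizon `k`, hence ALL of (2.6)–(2.9) and (2.46) at the horizon `k`
(`B14FlowStep.flowControl_of_avgAF`), hence the antecedent of `CondSmallFC` at `k`, hence `|δ_k| ≤ b/2`; and then
(2.6)–(2.9) ∧ (2.46) for the whole run.  Corollaries `absDelta_le_of_condSmall`, `flowControl_of_boundA` ((Δβ-a) with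
`D_a ≤ b/2` suffices), and (C′) `condSmallFC_of_boundA_pow` / `flowControl_of_boundA_pow` /
`flowControl_of_alphaBooking_pow`: the smallness in the pure-γ form `D_a·γ^{κ−6} ≤ b/2` — (2.46) at the horizon makes
the layer sum itself `< g_k^{κ−6} ≤ γ^{κ−6}`, so for `κ > 6` NO smallness of the reconstruction's constant is needed
(companion markdown §2.6, SMALLNESS.md).  (D) `betaContH_of_split`: the continuity clause of C14 under reading (α) —
the β sub-cell's hypothesis (C) (`FlowStep.BetaContH`, row an4) for the realised family `βᴵ + δ` follows from (C) for
[I]'s family (asserted in print, p. 264) plus the joint continuity of `δ` on the boxes (printed nowhere); continuity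
is additive, and that is the clause's whole formal content.  Reading (β) is unaffected
(`B14FlowStepPerturbed.rebooked_le_of_sum246`).
Vocabulary: `Setup.Flow`, `Flow.SatisfiesRG`, `Flow.InInterval`, `Setup.epsK`; `B12Beta.Kernel`, `B12Beta.secondMoment`;
`B14.FlowIneq26/27/28`, `B14.IsRj`; `B14FlowStep.FlowIneq29`, `SumIneq246`, `SmallnessFor`, `flowControl_of_avgAF`,
`sumIneq246_of_avgAF`; `B14FlowStepPerturbed.avgAF_of_split_absLe`; `FlowStep.HBeta`, `FlowStep.Box`, `FlowStep.BetaContH`.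
-/

namespace Literature.MathematicalPhysics.QuantumFieldTheory.Balaban1983to89.B14DeltaBeta

open Literature.MathematicalPhysics.QuantumFieldTheory.Balaban1983to89
open Literature.MathematicalPhysics.QuantumFieldTheory.Balaban1983to89.B14FlowStep
open Literature.MathematicalPhysics.QuantumFieldTheory.Balaban1983to89.B14FlowStepPerturbed
open Literature.MathematicalPhysics.QuantumFieldTheory.Balaban1983to89.B12Beta

/-! ## (A) What `δβ` is under reading (α): a difference of two instances of (I.1.20)–(I.1.22) -/

/-- Summability of the lattice sum in (1.22) for the pair `μ, ν` — the hypothesis under which the `tsum` typed in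
`B12Beta.secondMoment` is additive (its source in print is the exponential decay (I.5.10)/(I.5.44) of the kernel; for
the 𝐑′-perturbed family NOT displayed — part of GAPS G-B14s-18). [cite: Balaban1987RG1, (1.22) p.264] -/
def MomentSummable {d : ℕ} (P : Kernel d) (μ ν : Fin d) : Prop :=
  Summable fun x : Fin d → ℤ => P μ ν x * (x μ : ℝ) * (x ν : ℝ)

/-- (1.22) is LINEAR in the kernel: the second moment of a sum of two summable kernels is the sum of the second
moments. [folklore] -/
theorem secondMoment_add {d : ℕ} (P Q : Kernel d) (μ ν : Fin d) (hP : MomentSummable P μ ν)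
    (hQ : MomentSummable Q μ ν) : secondMoment (P + Q) μ ν = secondMoment P μ ν + secondMoment Q μ ν := by
  unfold secondMoment
  rw [← hP.tsum_add hQ]
  refine tsum_congr fun x => ?_
  simp only [Pi.add_apply]
  ring

/-- **READING (α), typed.**  Along a flow `F` (solving (0.20), `Setup.Flow`), for each scale `j < K`: `Pfull j` = the
polarization kernel (I.1.20)–(I.1.21) of B14's whole-lattice effective action `𝐄^{(j+1)}` built from the MERGED
`𝐄_j ⊇ 𝐑′_j` ([III] p. 271 *"The sum of the two expressions, 𝐑′_k and 𝐄_k, is denoted also by 𝐄_k"*, p. 278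
*"coincide with the corresponding terms arising from the expressions defined on the whole lattice"*), `PI j` = the same
functional applied to the 𝐑′-FREE family ([I]'s); `realised` = [III] p. 259 *"the coupling constants g_{j−1} are defined
as in (I.0.20)"* read as (α): the β-value in (2.24) IS (I.1.22) of B14's own family, *"for μ, ν arbitrary, μ ≠ ν"*; the two
summability fields are the convergence of the lattice sums ((I.5.10)/(I.5.44)-type decay; for the perturbed family NOT
displayed, GAPS G-B14s-18).  A structure of HYPOTHESES about abstract kernels; nothing about Bałaban's objects is
asserted, and neither reading (α) nor (β) is printed (GAPS G-B14s-22 §4). [cite: Balaban1987RG1, (1.20)–(1.22) p.264; Balaban1988Convergent, (2.24) p.259, p.271, p.278] -/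
structure AlphaBooking (F : Flow) (K d : ℕ) where
  μ : Fin d
  ν : Fin d
  hμν : μ ≠ ν
  Pfull : ℕ → Kernel d
  PI : ℕ → Kernel d
  realised : ∀ j, j < K → F.β (j + 1) (F.g j) = secondMoment (Pfull j) μ ν
  summableI : ∀ j, j < K → MomentSummable (PI j) μ ν
  summableR : ∀ j, j < K → MomentSummable (Pfull j - PI j) μ ν

namespace AlphaBooking

variable {F : Flow} {K d : ℕ} (A : AlphaBooking F K d)

/-- `βᴵ_j` := (I.1.22) of the 𝐑′-free kernel — [I]'s β-function value at B14's history. [cite: Balaban1987RG1, (1.22) p.264] -/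
noncomputable def βI (j : ℕ) : ℝ := secondMoment (A.PI j) A.μ A.ν

/-- `δβ_{j+1}` := (I.1.22) of the DIFFERENCE kernel `Π_full − Πᴵ` = the polarization of `D^{(j+1)} = 𝐄^{(j+1)}[𝐄_j ∪ 𝐑′_j]
− 𝐄^{(j+1)}[𝐄_j]` (linearity of (1.20) in `E`).  It depends on the whole history `g_0,…,g_j` AND on the 𝐑-apparatus
(`κ₀`, `R_j`, `M`, the p-functions).  Print displays no bound on it. [cite: Balaban1987RG1, (1.20)–(1.22) p.264] -/
noncomputable def δ (j : ℕ) : ℝ := secondMoment (A.Pfull j - A.PI j) A.μ A.ν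

/-- **The split is DERIVED, not posited**: `β_{j+1}(g_j) = βᴵ_j + δ_j` for `j < K` — the `hsplit` hypothesis of
`B14FlowStepPerturbed.absDelta_le_of_perturbedSplit`, from the printed linearity of (1.20)/(1.22). [cite: Balaban1987RG1, (1.22) p.264] -/
theorem split : ∀ j, j < K → F.β (j + 1) (F.g j) = A.βI j + A.δ j := by
  intro j hj
  have e : A.Pfull j = A.PI j + (A.Pfull j - A.PI j) := by abel
  rw [A.realised j hj, βI, δ]
  conv_lhs => rw [e]
  exact secondMoment_add _ _ _ _ (A.summableI j hj) (A.summableR j hj)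

end AlphaBooking

/-! ## (B) The shapes of the reconstructed bound, and the absorption arithmetic -/

/-- **Absorption of logarithms into one power of the coupling**: `g·(log g⁻²)^q ≤ (2q)^q` for `0 < g < 1`, `q ≥ 1`
(from `log x ≤ x^ε/ε` with `ε = 1/(2q)`).  This is how every polylogarithm `(log g_j⁻²)^m` of the reconstruction —
`p₀(g)³`, `α_{0,j}⁻²·g_j² = C₀⁻²(log g_j⁻²)^{−2q₀}`, `(MR_j)^{±a}` — is paid for by lowering the exponent `κ₀` by one
(`κ = κ₀ − 3 = (κ₀ − 2) − 1`), [III] p. 260: *"κ₀ can be chosen arbitrarily large"*. [folklore] -/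
theorem g_mul_logpow_le {g : ℝ} (hg : 0 < g) (hg1 : g < 1) {q : ℕ} (hq : 1 ≤ q) :
    g * (Real.log (g ^ 2)⁻¹) ^ q ≤ (2 * q : ℝ) ^ q := by
  set x : ℝ := (g ^ 2)⁻¹ with hx
  have hx0 : 0 < x := by positivity
  have hx1 : 1 ≤ x := by
    rw [hx, one_le_inv₀ (by positivity)]
    exact pow_le_one₀ hg.le hg1.le
  have hq0 : (0 : ℝ) < q := by exact_mod_cast hq
  have hε : (0 : ℝ) < 1 / (2 * q) := by positivity
  have hlog0 : 0 ≤ Real.log x := Real.log_nonneg hx1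
  have h1 : Real.log x ≤ x ^ (1 / (2 * (q : ℝ))) / (1 / (2 * q)) := Real.log_le_rpow_div hx0.le hε
  have h1' : Real.log x ≤ x ^ (1 / (2 * (q : ℝ))) * (2 * q) := by
    rw [div_div_eq_mul_div, div_one] at h1
    simpa using h1
  have h2 : (Real.log x) ^ q ≤ (x ^ (1 / (2 * (q : ℝ))) * (2 * q)) ^ q := pow_le_pow_left₀ hlog0 h1' q
  have h3 : (x ^ (1 / (2 * (q : ℝ)))) ^ q = g⁻¹ := by
    rw [← Real.rpow_natCast, ← Real.rpow_mul hx0.le]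
    have : 1 / (2 * (q : ℝ)) * (q : ℝ) = 1 / 2 := by field_simp
    rw [this, hx, ← Real.sqrt_eq_rpow, Real.sqrt_inv, Real.sqrt_sq hg.le]
  rw [mul_pow, h3] at h2
  calc g * (Real.log (g ^ 2)⁻¹) ^ q = g * (Real.log x) ^ q := by rw [hx]
    _ ≤ g * (g⁻¹ * (2 * q : ℝ) ^ q) := mul_le_mul_of_nonneg_left h2 hg.le
    _ = (2 * q : ℝ) ^ q := by field_simp

/-- Corollary used layer by layer: `g^(κ+1)·(log g⁻²)^q ≤ (2q)^q·g^κ` for `0 < g < 1`, `q ≥ 1` — a per-layer weight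
`g_j^{κ₀−2}·polylog(g_j)` is at most a constant times `g_j^{κ₀−3}`. [folklore] -/
theorem gpow_mul_logpow_le {g : ℝ} (hg : 0 < g) (hg1 : g < 1) {q : ℕ} (hq : 1 ≤ q) (κ : ℕ) :
    g ^ (κ + 1) * (Real.log (g ^ 2)⁻¹) ^ q ≤ (2 * q : ℝ) ^ q * g ^ κ := by
  have h := g_mul_logpow_le hg hg1 hq
  have hgκ : 0 ≤ g ^ κ := pow_nonneg hg.le κ
  calc g ^ (κ + 1) * (Real.log (g ^ 2)⁻¹) ^ q = g ^ κ * (g * (Real.log (g ^ 2)⁻¹) ^ q) := by ring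
    _ ≤ g ^ κ * (2 * q : ℝ) ^ q := mul_le_mul_of_nonneg_left h hgκ
    _ = (2 * q : ℝ) ^ q * g ^ κ := by ring

/-- **Conditional smallness, layer-sum form**: at every scale `k < K`, IF the layer sum `Σ_{j=1}^{k} g_j^κ` is `≤ 1`
THEN `|δ_k| ≤ θ`.  The weakest form of the (Δβ) input the bootstrap needs; both grades (Δβ-a)/(Δβ-b) of the
reconstruction imply it under a smallness condition on their constant (`condSmall_of_boundA`, `condSmall_of_flat`).
A `Prop`-valued shape; nothing asserted. [cite: Balaban1988Convergent, (2.46) p.263 and p.278] -/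
def CondSmall (g δ : ℕ → ℝ) (K κ : ℕ) (θ : ℝ) : Prop :=
  ∀ k, k < K → ∑ j ∈ Finset.Icc 1 k, (g j) ^ κ ≤ 1 → |δ k| ≤ θ

/-- The PRINTED flow facts up to the horizon `k`: (2.6), (2.7) (exponent `p`), (2.8) (for `ε_j = g_j p₀(g_j)`), (2.9)
(for the radii `R`), and the middle member of (2.46) (exponent `κ`) — exactly the conclusion of
`B14FlowStep.flowControl_of_avgAF` for the horizon `k`. [cite: Balaban1988Convergent, (2.6)–(2.9) pp.255–256, (2.46) p.263] -/
def HorizonFacts (F : Flow) (β'' β₀ A₀ : ℝ) (L p κ : ℕ) (R : ℕ → ℕ) (k : ℕ) : Prop :=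
  (B14.FlowIneq26 F.g β'' β₀ k ∧ B14.FlowIneq27 F.g β'' β₀ p k ∧
    B14.FlowIneq28 (epsK A₀ p F) F.g β'' β₀ k ∧ FlowIneq29 R F.g L β'' β₀ k) ∧ SumIneq246 F.g κ k

/-- **Conditional smallness, flow-facts form** (the honest typed interface of the reconstruction): at every scale
`k < K`, IF the printed flow facts (2.6)–(2.9) and (2.46) hold up to the horizon `k` THEN `|δ_k| ≤ θ`.  The
reconstruction of the companion markdown uses (2.7)/(2.9) (comparability of the polylogarithms and radii across the
layers `j < k`) and (2.46) (the layer sum) and nothing else about the flow; Bałaban's induction supplies them at the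
horizon, and so does the bootstrap below.  A shape; nothing asserted. [cite: Balaban1988Convergent, (2.6)–(2.9) pp.255–256, (2.46) p.263, p.278] -/
def CondSmallFC (F : Flow) (β'' β₀ A₀ : ℝ) (L p κ : ℕ) (R : ℕ → ℕ) (δ : ℕ → ℝ) (K : ℕ) (θ : ℝ) : Prop :=
  ∀ k, k < K → HorizonFacts F β'' β₀ A₀ L p κ R k → |δ k| ≤ θ

/-- **(Δβ-a), the sup-norm/Cauchy grade of the reconstruction** (NOT PRINTED; companion markdown §2.5): whenever the
layer sum is `≤ 1` (inside which the (k+1)-st expansion with the merged action converges at all),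
`|δ_k| ≤ D_a·Σ_{j=1}^{k} g_j^κ`, `κ = κ₀ − 3`, with NO factor `g_k²`: `D_a = O(1)·K₀L⁴(1+β₀)²(4m)^m/(M⁴C₀²C₁²c²)`-
type (order of magnitude only); what makes the right side small is the layer sum itself, `< g_k^{κ−6} ≤ γ^{κ−6}` by
(2.46) at the horizon (`condSmallFC_of_boundA_pow`).  A shape; nothing asserted. [cite: Balaban1988Convergent, (2.31) p.260, (2.46) p.263, p.278] -/
def DeltaBoundA (g δ : ℕ → ℝ) (K κ : ℕ) (Da : ℝ) : Prop :=
  ∀ k, k < K → ∑ j ∈ Finset.Icc 1 k, (g j) ^ κ ≤ 1 → |δ k| ≤ Da * ∑ j ∈ Finset.Icc 1 k, (g j) ^ κ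

/-- **The per-layer form of the reconstruction** (NOT PRINTED; companion markdown §2.4): whenever the layer sum is
`≤ 1`, `δ_k` is a sum over the layers `j = 1,…,k` of contributions `a_j` (the 𝐑^{(j)}-generated second-order pieces of
(3.37)/(3.47), summed over the scale-`j` localization domains meeting a unit cube — the count behind p. 260's
*"(Lʲη)⁴"* against the conversion factor `L^{−4(k−j)}` of the second-order flux structure: FLAT) with
`|a_j| ≤ D_a·g_j^κ`.  A shape; nothing asserted. [cite: Balaban1988Convergent, (2.31)–(2.33) p.260, p.278, p.283] -/
def PerScaleRep (g δ : ℕ → ℝ) (K κ : ℕ) (Da : ℝ) : Prop :=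
  ∀ k, k < K → ∑ j ∈ Finset.Icc 1 k, (g j) ^ κ ≤ 1 →
    ∃ a : ℕ → ℝ, δ k = ∑ j ∈ Finset.Icc 1 k, a j ∧ ∀ j ∈ Finset.Icc 1 k, |a j| ≤ Da * (g j) ^ κ

/-- Per-layer form ⟹ (Δβ-a): `|Σ_j a_j| ≤ Σ_j |a_j| ≤ D_a Σ_j g_j^κ`. [folklore] -/
theorem boundA_of_perScaleRep {g δ : ℕ → ℝ} {K κ : ℕ} {Da : ℝ} (h : PerScaleRep g δ K κ Da) :
    DeltaBoundA g δ K κ Da := by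
  intro k hk hS
  obtain ⟨a, hδ, ha⟩ := h k hk hS
  rw [hδ, Finset.mul_sum]
  exact (Finset.abs_sum_le_sum_abs _ _).trans (Finset.sum_le_sum ha)

/-- (Δβ-a) with `D_a ≤ θ` (and `D_a ≥ 0`) ⟹ conditional smallness: `|δ_k| ≤ D_a·Σ ≤ D_a ≤ θ`.  The smallness
condition `D_a ≤ b/2` replaces `Dγ² ≤ b/2` of the flat form — a condition on `γ, C₁, M` against the slope `b`
(companion markdown §2.6; SMALLNESS.md). [folklore] -/
theorem condSmall_of_boundA {g δ : ℕ → ℝ} {K κ : ℕ} {Da θ : ℝ} (hDa : 0 ≤ Da) (hDaθ : Da ≤ θ)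
    (h : DeltaBoundA g δ K κ Da) : CondSmall g δ K κ θ := by
  intro k hk hS
  calc |δ k| ≤ Da * ∑ j ∈ Finset.Icc 1 k, (g j) ^ κ := h k hk hS
    _ ≤ Da * 1 := mul_le_mul_of_nonneg_left hS hDa
    _ ≤ θ := by rw [mul_one]; exact hDaθ

/-- The strategist lineage's FLAT hypothesis (Δβ-b) `|δ_k| ≤ D·g_k²·Σ_{j≤k} g_j^κ` (unconditional, with the factor
`g_k²`; `B14FlowStepPerturbed.absDelta_le_of_perturbedSplit`) is a special case: along a flow in `]0,γ]` with
`Dγ² ≤ θ` it implies conditional smallness. [folklore] -/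
theorem condSmall_of_flat (F : Flow) (K : ℕ) {γ D θ : ℝ} {κ : ℕ} {δ : ℕ → ℝ} (hI : F.InInterval γ K) (hD : 0 ≤ D)
    (hδ : ∀ k, k < K → |δ k| ≤ D * (F.g k) ^ 2 * ∑ j ∈ Finset.Icc 1 k, (F.g j) ^ κ) (hDγ : D * γ ^ 2 ≤ θ) :
    CondSmall F.g δ K κ θ := by
  intro k hk hS
  have hgk := hI k hk.le
  have hg2 : (F.g k) ^ 2 ≤ γ ^ 2 := pow_le_pow_left₀ hgk.1.le hgk.2 2
  have hDg : 0 ≤ D * (F.g k) ^ 2 := mul_nonneg hD (sq_nonneg _)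
  calc |δ k| ≤ D * (F.g k) ^ 2 * ∑ j ∈ Finset.Icc 1 k, (F.g j) ^ κ := hδ k hk
    _ ≤ D * (F.g k) ^ 2 * 1 := mul_le_mul_of_nonneg_left hS hDg
    _ ≤ D * γ ^ 2 := by rw [mul_one]; exact mul_le_mul_of_nonneg_left hg2 hD
    _ ≤ θ := hDγ

/-- Layer-sum form ⟹ flow-facts form: the antecedent of `CondSmallFC` contains (2.46) at the horizon, which along a
flow in `]0,γ]`, `γ ≤ 1`, `κ ≥ 6` gives `Σ_{j≤k} g_j^κ < g_k^{κ−6} ≤ 1`. [folklore] -/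
theorem condSmallFC_of_condSmall (F : Flow) (K : ℕ) {γ β'' β₀ A₀ θ : ℝ} {L p κ : ℕ} {R : ℕ → ℕ} {δ : ℕ → ℝ}
    (hI : F.InInterval γ K) (hγ1 : γ ≤ 1) (h : CondSmall F.g δ K κ θ) :
    CondSmallFC F β'' β₀ A₀ L p κ R δ K θ := by
  intro k hk hfacts
  have h246 : ∑ j ∈ Finset.Icc 1 k, (F.g j) ^ κ < (F.g k) ^ (κ - 6) := hfacts.2 k le_rfl
  have hgk := hI k hk.le
  have hle1 : (F.g k) ^ (κ - 6) ≤ 1 := pow_le_one₀ hgk.1.le (hgk.2.trans hγ1)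
  exact h k hk (by linarith)

/-! ## (C) The bootstrap from conditional smallness -/

variable (F : Flow) (K : ℕ)

/-- **The bootstrap from the flow-facts form.**  Along a flow solving (0.20) in `]0,γ]` whose realised β-values split
as `β_{j+1}(g_j) = βᴵ_j + δ_j` (e.g. `AlphaBooking.split`) with (AvAF) `b(n−m) − B ≤ Σ_{[m,n)} βᴵ_j` (`b > 0`) and the
printed-type upper bound `βᴵ_j ≤ β′` for the [I]-part, the CONDITIONAL smallness `CondSmallFC` (flow facts ∧ (2.46)
up to the horizon `k` ⟹ `|δ_k| ≤ b/2`) and the γ-smallness of `B14FlowStep.flowControl_of_avgAF` for the bound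
`β′ + b/2` and slope `b/2` force `|δ_k| ≤ b/2` for EVERY `k < K` — strong induction on `k`: the induction hypothesis
gives (AvAF) with slope `b/2` (`avgAF_of_split_absLe`) and `β ≤ β′ + b/2` up to the horizon `k`, hence all of
(2.6)–(2.9) ∧ (2.46) at the horizon `k` (`flowControl_of_avgAF` for `K := k`), i.e. the antecedent of `CondSmallFC`
at `k`. [cite: Balaban1988Convergent, (2.6)–(2.9) pp.255–256, (2.46) p.263, p.278] -/
theorem absDelta_le_of_condSmallFC {γ β' β₀ b B A₀ : ℝ} {L p κ : ℕ}
    (S : SmallnessFor γ (β' + b / 2) β₀ L p) (hA₀ : 0 ≤ A₀)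
    (R : ℕ → ℕ) (hR : ∀ j, j ≤ K → B14.IsRj L p (F.g j) (R j)) (βI δ : ℕ → ℝ)
    (hrg : F.SatisfiesRG K) (hI : F.InInterval γ K)
    (hsplit : ∀ j, j < K → F.β (j + 1) (F.g j) = βI j + δ j)
    (hubI : ∀ j, j < K → βI j ≤ β') (hb : 0 < b)
    (havI : ∀ m n, m ≤ n → n ≤ K → b * ((n : ℝ) - m) - B ≤ ∑ j ∈ Finset.Ico m n, βI j)
    (hcs : CondSmallFC F (β' + b / 2) β₀ A₀ L p κ R δ K (b / 2))
    (hκ : 6 ≤ κ) (hBγ : B * γ ^ 2 ≤ β₀ * (2 + β₀)) (hBγ' : B * γ ^ 2 ≤ 1 / 2)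
    (hsmall : Real.sqrt 2 ^ (κ - 6) * (2 * γ ^ 4 / (b / 2) + γ ^ 6) < 1) :
    ∀ k, k < K → |δ k| ≤ b / 2 := by
  intro k
  induction k using Nat.strong_induction_on with
  | _ k ih =>
    intro hkK
    have hkK' : k ≤ K := hkK.le
    -- (AvAF) with slope b/2 up to the horizon k, from the induction hypothesis
    have hav : ∀ m n, m ≤ n → n ≤ k →
        b / 2 * ((n : ℝ) - m) - B ≤ ∑ j ∈ Finset.Ico m n, F.β (j + 1) (F.g j) := by
      intro m n hmn hnk
      have h := avgAF_of_split_absLe F K βI δ hkK' hsplit havI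
        (fun j hj => ih j hj (lt_trans hj hkK)) m n hmn hnk
      have e : b - b / 2 = b / 2 := by ring
      rw [e] at h
      exact h
    -- the upper bound β ≤ β' + b/2 up to the horizon k
    have hub : ∀ j, j < k → F.β (j + 1) (F.g j) ≤ β' + b / 2 := by
      intro j hj
      rw [hsplit j (lt_trans hj hkK)]
      have := (abs_le.mp (ih j hj (lt_trans hj hkK))).2
      linarith [hubI j (lt_trans hj hkK)]
    have hrgk : F.SatisfiesRG k := fun j hj => hrg j (lt_of_lt_of_le hj hkK')
    have hIk : F.InInterval γ k := fun j hj => hI j (hj.trans hkK')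
    have hRk : ∀ j, j ≤ k → B14.IsRj L p (F.g j) (R j) := fun j hj => hR j (hj.trans hkK')
    -- all printed flow facts and (2.46) at the horizon k
    have hfacts : HorizonFacts F (β' + b / 2) β₀ A₀ L p κ R k :=
      flowControl_of_avgAF F k S hA₀ R hRk hrgk hIk hub (half_pos hb) hav hBγ hBγ' hκ hsmall
    exact hcs k hkK hfacts

/-- **T11.F headline from the flow-facts form**: under the hypotheses of `absDelta_le_of_condSmallFC`, ALL of
(2.6)–(2.9) with the printed constants (bound `β′ + b/2`) and the middle member of (2.46) hold for the whole run —
uniformly in `K`; the (Δβ) input consumed is only the conditional form. [cite: Balaban1988Convergent, (2.6)–(2.9) pp.255–256, (2.46) p.263, p.278] -/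
theorem flowControl_of_condSmallFC {γ β' β₀ b B A₀ : ℝ} {L p κ : ℕ}
    (S : SmallnessFor γ (β' + b / 2) β₀ L p) (hA₀ : 0 ≤ A₀)
    (R : ℕ → ℕ) (hR : ∀ j, j ≤ K → B14.IsRj L p (F.g j) (R j)) (βI δ : ℕ → ℝ)
    (hrg : F.SatisfiesRG K) (hI : F.InInterval γ K)
    (hsplit : ∀ j, j < K → F.β (j + 1) (F.g j) = βI j + δ j)
    (hubI : ∀ j, j < K → βI j ≤ β') (hb : 0 < b)
    (havI : ∀ m n, m ≤ n → n ≤ K → b * ((n : ℝ) - m) - B ≤ ∑ j ∈ Finset.Ico m n, βI j)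
    (hcs : CondSmallFC F (β' + b / 2) β₀ A₀ L p κ R δ K (b / 2))
    (hκ : 6 ≤ κ) (hBγ : B * γ ^ 2 ≤ β₀ * (2 + β₀)) (hBγ' : B * γ ^ 2 ≤ 1 / 2)
    (hsmall : Real.sqrt 2 ^ (κ - 6) * (2 * γ ^ 4 / (b / 2) + γ ^ 6) < 1) :
    HorizonFacts F (β' + b / 2) β₀ A₀ L p κ R K := by
  have hδ' := absDelta_le_of_condSmallFC F K S hA₀ R hR βI δ hrg hI hsplit hubI hb havI hcs hκ hBγ hBγ' hsmall
  have hav : ∀ m n, m ≤ n → n ≤ K →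
      b / 2 * ((n : ℝ) - m) - B ≤ ∑ j ∈ Finset.Ico m n, F.β (j + 1) (F.g j) := by
    intro m n hmn hnK
    have h := avgAF_of_split_absLe F K βI δ le_rfl hsplit havI hδ' m n hmn hnK
    have e : b - b / 2 = b / 2 := by ring
    rw [e] at h
    exact h
  have hub : ∀ j, j < K → F.β (j + 1) (F.g j) ≤ β' + b / 2 := by
    intro j hj
    rw [hsplit j hj]
    have := (abs_le.mp (hδ' j hj)).2
    linarith [hubI j hj]
  exact flowControl_of_avgAF F K S hA₀ R hR hrg hI hub (half_pos hb) hav hBγ hBγ' hκ hsmall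

/-- The bootstrap from the LAYER-SUM form of conditional smallness (no flow facts in the antecedent). [cite: Balaban1988Convergent, (2.46) p.263, p.278] -/
theorem absDelta_le_of_condSmall {γ β' β₀ b B A₀ : ℝ} {L p κ : ℕ}
    (S : SmallnessFor γ (β' + b / 2) β₀ L p) (hA₀ : 0 ≤ A₀)
    (R : ℕ → ℕ) (hR : ∀ j, j ≤ K → B14.IsRj L p (F.g j) (R j)) (βI δ : ℕ → ℝ)
    (hrg : F.SatisfiesRG K) (hI : F.InInterval γ K)
    (hsplit : ∀ j, j < K → F.β (j + 1) (F.g j) = βI j + δ j)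
    (hubI : ∀ j, j < K → βI j ≤ β') (hb : 0 < b)
    (havI : ∀ m n, m ≤ n → n ≤ K → b * ((n : ℝ) - m) - B ≤ ∑ j ∈ Finset.Ico m n, βI j)
    (hcs : CondSmall F.g δ K κ (b / 2))
    (hκ : 6 ≤ κ) (hBγ : B * γ ^ 2 ≤ β₀ * (2 + β₀)) (hBγ' : B * γ ^ 2 ≤ 1 / 2)
    (hsmall : Real.sqrt 2 ^ (κ - 6) * (2 * γ ^ 4 / (b / 2) + γ ^ 6) < 1) :
    ∀ k, k < K → |δ k| ≤ b / 2 :=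
  absDelta_le_of_condSmallFC F K S hA₀ R hR βI δ hrg hI hsplit hubI hb havI
    (condSmallFC_of_condSmall F K hI S.γ_lt_one.le hcs) hκ hBγ hBγ' hsmall

/-- **T11.F from the (Δβ-a) grade**: the sup-norm/Cauchy grade of the reconstruction, `Σ_{j≤k} g_j^κ ≤ 1 ⟹ |δ_k| ≤
D_a Σ_{j≤k} g_j^κ`, with the smallness `0 ≤ D_a ≤ b/2` (NO factor `g_k²` needed), gives all of (2.6)–(2.9) and (2.46)
for the perturbed flow. [cite: Balaban1988Convergent, (2.6)–(2.9) pp.255–256, (2.46) p.263, p.278] -/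
theorem flowControl_of_boundA {γ β' β₀ b B A₀ Da : ℝ} {L p κ : ℕ}
    (S : SmallnessFor γ (β' + b / 2) β₀ L p) (hA₀ : 0 ≤ A₀)
    (R : ℕ → ℕ) (hR : ∀ j, j ≤ K → B14.IsRj L p (F.g j) (R j)) (βI δ : ℕ → ℝ)
    (hrg : F.SatisfiesRG K) (hI : F.InInterval γ K)
    (hsplit : ∀ j, j < K → F.β (j + 1) (F.g j) = βI j + δ j)
    (hubI : ∀ j, j < K → βI j ≤ β') (hb : 0 < b)
    (havI : ∀ m n, m ≤ n → n ≤ K → b * ((n : ℝ) - m) - B ≤ ∑ j ∈ Finset.Ico m n, βI j)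
    (hDa : 0 ≤ Da) (hA : DeltaBoundA F.g δ K κ Da) (hDab : Da ≤ b / 2)
    (hκ : 6 ≤ κ) (hBγ : B * γ ^ 2 ≤ β₀ * (2 + β₀)) (hBγ' : B * γ ^ 2 ≤ 1 / 2)
    (hsmall : Real.sqrt 2 ^ (κ - 6) * (2 * γ ^ 4 / (b / 2) + γ ^ 6) < 1) :
    HorizonFacts F (β' + b / 2) β₀ A₀ L p κ R K :=
  flowControl_of_condSmallFC F K S hA₀ R hR βI δ hrg hI hsplit hubI hb havI
    (condSmallFC_of_condSmall F K hI S.γ_lt_one.le (condSmall_of_boundA hDa hDab hA)) hκ hBγ hBγ' hsmall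

/-- **T11.F from a typed reading-(α) booking and the per-layer form**: if the flow's β-values are the (1.22)-moments of
B14's own kernels (`AlphaBooking`), the [I]-parts satisfy (AvAF) and `≤ β′`, and the perturbation has the per-layer
form `PerScaleRep` with `0 ≤ D_a ≤ b/2`, then all of (2.6)–(2.9) and (2.46) hold — the end-to-end statement of what
reading (α) costs: (AvAF) for [I]'s β (the β sub-cell's wall), the NOT PRINTED per-layer estimate, and γ/C₁/M-smallness.
[cite: Balaban1988Convergent, (2.6)–(2.9) pp.255–256, (2.46) p.263, p.278; Balaban1987RG1, (1.22) p.264] -/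
theorem flowControl_of_alphaBooking {d : ℕ} (A : AlphaBooking F K d) {γ β' β₀ b B A₀ Da : ℝ} {L p κ : ℕ}
    (S : SmallnessFor γ (β' + b / 2) β₀ L p) (hA₀ : 0 ≤ A₀)
    (R : ℕ → ℕ) (hR : ∀ j, j ≤ K → B14.IsRj L p (F.g j) (R j))
    (hrg : F.SatisfiesRG K) (hI : F.InInterval γ K)
    (hubI : ∀ j, j < K → A.βI j ≤ β') (hb : 0 < b)
    (havI : ∀ m n, m ≤ n → n ≤ K → b * ((n : ℝ) - m) - B ≤ ∑ j ∈ Finset.Ico m n, A.βI j)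
    (hDa : 0 ≤ Da) (hrep : PerScaleRep F.g A.δ K κ Da) (hDab : Da ≤ b / 2)
    (hκ : 6 ≤ κ) (hBγ : B * γ ^ 2 ≤ β₀ * (2 + β₀)) (hBγ' : B * γ ^ 2 ≤ 1 / 2)
    (hsmall : Real.sqrt 2 ^ (κ - 6) * (2 * γ ^ 4 / (b / 2) + γ ^ 6) < 1) :
    HorizonFacts F (β' + b / 2) β₀ A₀ L p κ R K :=
  flowControl_of_boundA F K S hA₀ R hR A.βI A.δ hrg hI A.split hubI hb havI hDa (boundA_of_perScaleRep hrep) hDab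
    hκ hBγ hBγ' hsmall

/-! ## (C′) The smallness in the pure-γ form: (2.46) at the horizon makes the layer sum itself small -/

/-- (Δβ-a) ⟹ flow-facts form with the WEAKER smallness `D_a·γ^{κ−6} ≤ θ`: the antecedent of `CondSmallFC` contains
(2.46) at the horizon, `Σ_{j≤k} g_j^κ < g_k^{κ−6} ≤ γ^{κ−6}` along a flow in `]0,γ]`, `γ ≤ 1`; so no smallness of
`D_a` itself is needed — for every value of the reconstruction's constant the bound is small once `γ` is (`κ > 6`).
[cite: Balaban1988Convergent, (2.46) p.263, p.278] -/
theorem condSmallFC_of_boundA_pow {γ β'' β₀ A₀ θ Da : ℝ} {L p κ : ℕ} {R : ℕ → ℕ} {δ : ℕ → ℝ}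
    (hI : F.InInterval γ K) (hγ1 : γ ≤ 1) (hDa : 0 ≤ Da) (hA : DeltaBoundA F.g δ K κ Da)
    (hDaγ : Da * γ ^ (κ - 6) ≤ θ) : CondSmallFC F β'' β₀ A₀ L p κ R δ K θ := by
  intro k hk hfacts
  have h246 : ∑ j ∈ Finset.Icc 1 k, (F.g j) ^ κ < (F.g k) ^ (κ - 6) := hfacts.2 k le_rfl
  have hgk := hI k hk.le
  have hpowγ : (F.g k) ^ (κ - 6) ≤ γ ^ (κ - 6) := pow_le_pow_left₀ hgk.1.le hgk.2 _
  have hγpow1 : γ ^ (κ - 6) ≤ 1 := pow_le_one₀ (hgk.1.le.trans hgk.2) hγ1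
  have hS1 : ∑ j ∈ Finset.Icc 1 k, (F.g j) ^ κ ≤ 1 := by linarith
  calc |δ k| ≤ Da * ∑ j ∈ Finset.Icc 1 k, (F.g j) ^ κ := hA k hk hS1
    _ ≤ Da * γ ^ (κ - 6) := mul_le_mul_of_nonneg_left (by linarith) hDa
    _ ≤ θ := hDaγ

/-- **T11.F from the (Δβ-a) grade, pure-γ smallness**: as `flowControl_of_boundA`, with `D_a ≤ b/2` replaced by
`D_a·γ^{κ−6} ≤ b/2` — for `κ > 6` a condition on `γ` alone, whatever the reconstruction's constant `D_a ≥ 0` is.  This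
is the form in which the (Δβ-a) grade enters SMALLNESS.md. [cite: Balaban1988Convergent, (2.6)–(2.9) pp.255–256, (2.46) p.263, p.278] -/
theorem flowControl_of_boundA_pow {γ β' β₀ b B A₀ Da : ℝ} {L p κ : ℕ}
    (S : SmallnessFor γ (β' + b / 2) β₀ L p) (hA₀ : 0 ≤ A₀)
    (R : ℕ → ℕ) (hR : ∀ j, j ≤ K → B14.IsRj L p (F.g j) (R j)) (βI δ : ℕ → ℝ)
    (hrg : F.SatisfiesRG K) (hI : F.InInterval γ K)
    (hsplit : ∀ j, j < K → F.β (j + 1) (F.g j) = βI j + δ j)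
    (hubI : ∀ j, j < K → βI j ≤ β') (hb : 0 < b)
    (havI : ∀ m n, m ≤ n → n ≤ K → b * ((n : ℝ) - m) - B ≤ ∑ j ∈ Finset.Ico m n, βI j)
    (hDa : 0 ≤ Da) (hA : DeltaBoundA F.g δ K κ Da) (hDab : Da * γ ^ (κ - 6) ≤ b / 2)
    (hκ : 6 ≤ κ) (hBγ : B * γ ^ 2 ≤ β₀ * (2 + β₀)) (hBγ' : B * γ ^ 2 ≤ 1 / 2)
    (hsmall : Real.sqrt 2 ^ (κ - 6) * (2 * γ ^ 4 / (b / 2) + γ ^ 6) < 1) :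
    HorizonFacts F (β' + b / 2) β₀ A₀ L p κ R K :=
  flowControl_of_condSmallFC F K S hA₀ R hR βI δ hrg hI hsplit hubI hb havI
    (condSmallFC_of_boundA_pow F K hI S.γ_lt_one.le hDa hA hDab) hκ hBγ hBγ' hsmall

/-- **T11.F from a typed reading-(α) booking and the per-layer form, pure-γ smallness**: as
`flowControl_of_alphaBooking` with `D_a·γ^{κ−6} ≤ b/2` in place of `D_a ≤ b/2`.
[cite: Balaban1988Convergent, (2.6)–(2.9) pp.255–256, (2.46) p.263, p.278; Balaban1987RG1, (1.22) p.264] -/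
theorem flowControl_of_alphaBooking_pow {d : ℕ} (A : AlphaBooking F K d) {γ β' β₀ b B A₀ Da : ℝ} {L p κ : ℕ}
    (S : SmallnessFor γ (β' + b / 2) β₀ L p) (hA₀ : 0 ≤ A₀)
    (R : ℕ → ℕ) (hR : ∀ j, j ≤ K → B14.IsRj L p (F.g j) (R j))
    (hrg : F.SatisfiesRG K) (hI : F.InInterval γ K)
    (hubI : ∀ j, j < K → A.βI j ≤ β') (hb : 0 < b)
    (havI : ∀ m n, m ≤ n → n ≤ K → b * ((n : ℝ) - m) - B ≤ ∑ j ∈ Finset.Ico m n, A.βI j)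
    (hDa : 0 ≤ Da) (hrep : PerScaleRep F.g A.δ K κ Da) (hDab : Da * γ ^ (κ - 6) ≤ b / 2)
    (hκ : 6 ≤ κ) (hBγ : B * γ ^ 2 ≤ β₀ * (2 + β₀)) (hBγ' : B * γ ^ 2 ≤ 1 / 2)
    (hsmall : Real.sqrt 2 ^ (κ - 6) * (2 * γ ^ 4 / (b / 2) + γ ^ 6) < 1) :
    HorizonFacts F (β' + b / 2) β₀ A₀ L p κ R K :=
  flowControl_of_boundA_pow F K S hA₀ R hR A.βI A.δ hrg hI A.split hubI hb havI hDa (boundA_of_perScaleRep hrep)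
    hDab hκ hBγ hBγ' hsmall

/-! ## (D) The continuity clause of C14 under reading (α) -/

/-- Under reading (α) the realised family is `βᴵ + δ` (history-typed, `FlowStep.HBeta`: `β k (g_0,…,g_k)`), so the
joint-continuity hypothesis (C) of the β sub-cell's carrier (`FlowStep.BetaContH`, row an4; `Beta.Assembly`) for the
REALISED family follows from (C) for [I]'s family — asserted in print for [I]'s function, p. 264: *"It is a smooth
function defined on the interval [0,γ], (or analytic), uniformly bounded on this interval together with all
derivatives."* — plus the joint continuity of `δ` on the boxes, which is printed NOWHERE ([III] states no regularity
of its 𝐑-terms in the couplings; p. 260: *"The above property will follow immediately from the construction of the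
𝐑-terms given in the next paper."*).  Continuity is additive; that is the clause's whole formal content.
[cite: Balaban1987RG1, §1 p.264; Balaban1988Convergent, p.260] -/
theorem betaContH_of_split {γ : ℝ} {β βI δ : FlowStep.HBeta}
    (hsplit : ∀ k v, v ∈ FlowStep.Box γ k → β k v = βI k v + δ k v)
    (hI : FlowStep.BetaContH γ βI) (hδ : FlowStep.BetaContH γ δ) : FlowStep.BetaContH γ β := by
  intro k
  exact ((hI k).add (hδ k)).congr (fun v hv => hsplit k v hv)

end Literature.MathematicalPhysics.QuantumFieldTheory.Balaban1983to89.B14DeltaBeta
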